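import Literature.MathematicalPhysics.KineticTheory.Hilbert6Wave0Proofs
import Literature.MathematicalPhysics.KineticTheory.HardSphereEuler
import HarnessLib

/-!
# Contact-isotropic product velocity laws are Maxwellian

Helper file (`--supports`) of the crux `LambertianContactSwap.LambertianEuler`
(`AtomisticToContinuum/HydrodynamicLimit`, stmt-AtomisticToContinuum-11854), line `Sketch`, stub
`stub_contactIsotropicMaxwellian : ContactIsotropyRigidity`.

In the Lambertian hard-sphere gas a product velocity law `∏ h(vᵢ)` has zero contact entropy
production iff the pair product `h(c + r n) h(c − r n)` does not depend on the unit vector `n`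
(`c` = centre-of-mass velocity, `r` = half the relative speed). We prove that a positive
continuous `h : ℝ³ → ℝ` with this property is a (wide-sense) Maxwellian
`h v = exp (a + ⟪b, v⟫ + c ‖v‖²)` (`contactIsotropyRigidity`).

Proof. An elastic collision `(v, w) ↦ (v', w') = collide ω (v, w)` keeps the centre of mass
`c = (v + w)/2` and reflects the relative velocity `g = v − w` to `g' = g − 2⟪g, ω⟫ ω`, which has
the same norm; so `v = c + (‖g‖/2) ĝ`, `w = c − (‖g‖/2) ĝ`, `v' = c + (‖g‖/2) ĝ'`,
`w' = c − (‖g‖/2) ĝ'` with unit vectors `ĝ, ĝ'`, and the hypothesis gives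
`h v' h w' = h v h w` (`mul_collide_eq_mul`). Hence `log ∘ h` is a continuous collision invariant,
which in velocity dimension `3 ≥ 2` is a quadratic polynomial `a + ⟪b, v⟫ + c ‖v‖²` by the tree's
proved classification theorem
`Literature.MathematicalPhysics.KineticTheory.IsCollisionInvariant.exists_eq_quadratic_holds`
(Boltzmann–Gronwall–Carleman; Cercignani–Illner–Pulvirenti 1994, Thm 3.1.1); exponentiate.
-/

noncomputable section

open Metric
open scoped InnerProductSpace

namespace Summit.AtomisticToContinuum.HydrodynamicLimit.Theorems.LambertianContactSwapLambertianEulerContactIsotropy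

open Literature.MathematicalPhysics.KineticTheory

/-- Reflecting a vector `g` in the hyperplane orthogonal to a unit vector `ω`,
`g ↦ g − 2⟪g, ω⟫ ω`, preserves the norm. [folklore] -/
theorem norm_sub_two_mul_inner_smul (ω : sphere (0 : V3) 1) (g : V3) :
    ‖g - (2 * ⟪g, (ω : V3)⟫_ℝ) • (ω : V3)‖ = ‖g‖ := by
  have hω : ‖(ω : V3)‖ = 1 := norm_eq_of_mem_sphere ω
  have hsq : ‖g - (2 * ⟪g, (ω : V3)⟫_ℝ) • (ω : V3)‖ ^ 2 = ‖g‖ ^ 2 := by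
    rw [norm_sub_sq_real, norm_smul, inner_smul_right, hω, Real.norm_eq_abs, mul_one, sq_abs]
    ring
  exact (sq_eq_sq₀ (norm_nonneg _) (norm_nonneg _)).mp hsq

/-- **Contact isotropy of the pair product is invariance under elastic collisions.** If the pair
product `h(c + r n) h(c − r n)` of a velocity law `h` on `ℝ³` does not depend on the unit vector
`n`, then `h v' h w' = h v h w` for every elastic collision `(v', w') = collide ω (v, w)`: the
collision keeps the centre of mass `(v + w)/2` and the relative speed `‖v − w‖` and only turns the
relative velocity (by the reflection `g ↦ g − 2⟪g, ω⟫ ω`; cf. Cercignani–Illner–Pulvirenti 1994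
§3.1). [folklore] -/
theorem mul_collide_eq_mul {h : V3 → ℝ}
    (hiso : ∀ (c : V3) (r : ℝ) (n n' : V3), ‖n‖ = 1 → ‖n'‖ = 1 →
      h (c + r • n) * h (c - r • n) = h (c + r • n') * h (c - r • n'))
    (ω : sphere (0 : V3) 1) (p : V3 × V3) :
    h (collide ω p).1 * h (collide ω p).2 = h p.1 * h p.2 := by
  obtain ⟨v, w⟩ := p
  by_cases hg : v - w = 0
  · obtain rfl : v = w := sub_eq_zero.mp hg
    simp [collide]
  obtain ⟨s, hs⟩ : ∃ s : ℝ, ⟪v - w, (ω : V3)⟫_ℝ = s := ⟨_, rfl⟩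
  have hnorm : ‖v - w‖ ≠ 0 := norm_ne_zero_iff.mpr hg
  -- the reflected relative velocity has the same norm
  have hg' : ‖(v - w) - (2 * s) • (ω : V3)‖ = ‖v - w‖ := by
    rw [← hs]; exact norm_sub_two_mul_inner_smul ω (v - w)
  -- the two unit vectors: directions of the incoming and outgoing relative velocities
  have hn : ‖‖v - w‖⁻¹ • (v - w)‖ = 1 := by
    rw [norm_smul, norm_inv, norm_norm, inv_mul_cancel₀ hnorm]
  have hn' : ‖‖v - w‖⁻¹ • ((v - w) - (2 * s) • (ω : V3))‖ = 1 := by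
    rw [norm_smul, norm_inv, norm_norm, hg', inv_mul_cancel₀ hnorm]
  have H := hiso ((2⁻¹ : ℝ) • (v + w)) (‖v - w‖ / 2) _ _ hn hn'
  have h2 : ‖v - w‖ / 2 * ‖v - w‖⁻¹ = 2⁻¹ := by
    field_simp
  rw [smul_smul, smul_smul, h2] at H
  have e1 : (2⁻¹ : ℝ) • (v + w) + (2⁻¹ : ℝ) • (v - w) = v := by module
  have e2 : (2⁻¹ : ℝ) • (v + w) - (2⁻¹ : ℝ) • (v - w) = w := by module
  have e3 : (2⁻¹ : ℝ) • (v + w) + (2⁻¹ : ℝ) • ((v - w) - (2 * s) • (ω : V3)) =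
      (collide ω (v, w)).1 := by
    simp only [collide, hs]; module
  have e4 : (2⁻¹ : ℝ) • (v + w) - (2⁻¹ : ℝ) • ((v - w) - (2 * s) • (ω : V3)) =
      (collide ω (v, w)).2 := by
    simp only [collide, hs]; module
  rw [e1, e2, e3, e4] at H
  exact H.symm

/-- **Contact-isotropic product states are Maxwellian** (stub `stub_contactIsotropicMaxwellian`
of line `Sketch` of the crux `LambertianContactSwap.LambertianEuler`). A positive continuous
one-particle velocity law `h` on `ℝ³` whose pair product `h(c + r n) h(c − r n)` does not depend on
the unit vector `n` — zero Lambertian contact entropy production of the product state `∏ h(vᵢ)`,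
the ideal-gas kernel of the Boltzmann-hypothesis barrier transported into the Lambertian gas — is
a (wide-sense) Maxwellian: by `mul_collide_eq_mul`, `log ∘ h` is a continuous collision
invariant, hence quadratic by the classification of continuous collision invariants in velocity
dimension `≥ 2` (`IsCollisionInvariant.exists_eq_quadratic_holds`, Boltzmann–Gronwall–Carleman);
exponentiate. [cite: CIP1994, Thm 3.1.1] -/
theorem contactIsotropyRigidity : ∀ h : V3 → ℝ, (∀ v, 0 < h v) → Continuous h →
    (∀ (c : V3) (r : ℝ) (n n' : V3), ‖n‖ = 1 → ‖n'‖ = 1 →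
      h (c + r • n) * h (c - r • n) = h (c + r • n') * h (c - r • n')) →
    IsMaxwellian h := by
  intro h hpos hcont hiso
  have hφc : Continuous fun v => Real.log (h v) := hcont.log fun v => (hpos v).ne'
  have hφ : IsCollisionInvariant fun v => Real.log (h v) := by
    intro ω p
    show Real.log (h (collide ω p).1) + Real.log (h (collide ω p).2) =
      Real.log (h p.1) + Real.log (h p.2)
    rw [← Real.log_mul (hpos (collide ω p).1).ne' (hpos (collide ω p).2).ne',
      ← Real.log_mul (hpos p.1).ne' (hpos p.2).ne', mul_collide_eq_mul hiso ω p]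
  have hE : 2 ≤ Module.finrank ℝ V3 := by
    rw [finrank_euclideanSpace_fin]; norm_num
  obtain ⟨a, c, b, habc⟩ := IsCollisionInvariant.exists_eq_quadratic_holds hE hφ hφc
  exact ⟨a, c, b, fun v => by rw [← habc v, Real.exp_log (hpos v)]⟩

/-- Registered stub `stub_contactIsotropicMaxwellian` of line `Sketch` (crux stmt-AtomisticToContinuum-11854). [folklore] -/
theorem stub_contactIsotropicMaxwellian :
    ∀ h : V3 → ℝ, (∀ v, 0 < h v) → Continuous h →
    (∀ (c : V3) (r : ℝ) (n n' : V3), ‖n‖ = 1 → ‖n'‖ = 1 →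
      h (c + r • n) * h (c - r • n) = h (c + r • n') * h (c - r • n')) →
    IsMaxwellian h :=
  contactIsotropyRigidity

end Summit.AtomisticToContinuum.HydrodynamicLimit.Theorems.LambertianContactSwapLambertianEulerContactIsotropy

end
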